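import Mathlib.Analysis.Calculus.MeanValue
import Mathlib.Analysis.InnerProductSpace.Projection.FiniteDimensional
import Mathlib.Analysis.SpecialFunctions.Trigonometric.Deriv
import Mathlib.Geometry.Euclidean.Angle.Unoriented.Basic
import HarnessLib

/-!
# Oscillation of a function over a spherical shell from a gradient bound

Analysis/FluidPDE support file (everything PROVED; elementary) on the discharge path of the
named fact `Literature.Analysis.FluidPDE.sereginWang_liouville_L3_annulus` (Seregin–Wang 2020,
Thm 1.1 (i): the harmonic part `h` of the pressure on an annulus `{a ≤ |x| ≤ b}` is controlled
in `L^{3/2}` by `|{a ≤ |x| ≤ b}|^{2/3} · osc h`, and the oscillation by `sup |∇h|` times the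
length of paths INSIDE the shell).

A closed spherical shell `S = {a ≤ |x| ≤ b}` (`0 < a ≤ b`) of a real inner product space of
dimension `≥ 2` is not convex, but any two of its points are joined inside `S` by a radial
segment followed by an arc of a great circle, of total length `≤ (b - a) + π b`.  Hence, for a
differentiable `h` with `‖∇h‖ ≤ B` on `S`,

  `|h(x) - h(y)| ≤ B ((b - a) + π b)`   for all `x, y ∈ S`   (`abs_sub_le_of_norm_fderiv_le_shell`).

* `exists_inner_eq_zero_norm_eq` — in dimension `≥ 2` every vector has an orthogonal vector of
  any prescribed norm;
* `exists_eq_cos_angle_smul_add_sin_angle_smul` — two vectors `u`, `v` of the same norm `r > 0`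
  span a great circle: `v = cos θ • u + sin θ • e` with `θ = ∠(u, v)`, `e ⊥ u`, `‖e‖ = r`;
* `abs_sub_le_great_circle` — the mean value inequality along the arc
  `t ↦ cos t • u + sin t • e`, `t ∈ [0, θ]` (which stays on the sphere of radius `r`):
  `|h(v) - h(u)| ≤ B r θ`;
* `abs_sub_le_radial_segment` — the mean value inequality along the radial segment from `x` to
  `(s/‖x‖) x`;
* `abs_sub_le_of_norm_fderiv_le_shell` — the shell estimate.

## Mathlib search

`Convex.norm_image_sub_le_of_norm_fderiv_le` (convex sets only), `InnerProductGeometry.angle`,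
`norm_image_sub_le_of_norm_deriv_le_segment'`, `Submodule.finrank_add_finrank_orthogonal`
(used); no path-connectedness-with-length or geodesic statement for annuli/spheres
(`lean search 'shell|annulus.*osc|great_circle'`: nothing relevant).
-/

noncomputable section

open Set Metric InnerProductGeometry Module

namespace Literature.Analysis.FluidPDE

variable {E : Type*} [NormedAddCommGroup E] [InnerProductSpace ℝ E] [FiniteDimensional ℝ E]

open scoped RealInnerProductSpace

/-- In dimension `≥ 2`, every vector `u` admits an orthogonal vector of any norm `r ≥ 0`.
[folklore] -/
theorem exists_inner_eq_zero_norm_eq (hE : 2 ≤ finrank ℝ E) (u : E) {r : ℝ} (hr : 0 ≤ r) :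
    ∃ e : E, ⟪u, e⟫ = 0 ∧ ‖e‖ = r := by
  haveI : Nontrivial E := Module.nontrivial_of_finrank_pos (R := ℝ) (by omega)
  -- a non-zero vector orthogonal to `u`
  obtain ⟨e₀, he₀u, he₀⟩ : ∃ e₀ : E, ⟪u, e₀⟫ = 0 ∧ e₀ ≠ 0 := by
    by_cases hu : u = 0
    · obtain ⟨e₀, he₀⟩ := exists_ne (0 : E)
      exact ⟨e₀, by simp [hu], he₀⟩
    · set K : Submodule ℝ E := ℝ ∙ u with hK
      have hK1 : finrank ℝ K = 1 := finrank_span_singleton hu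
      have hsum := Submodule.finrank_add_finrank_orthogonal K
      have hKo : Kᗮ ≠ ⊥ := by
        intro hbot
        rw [hbot, finrank_bot] at hsum
        omega
      obtain ⟨e₀, he₀K, he₀⟩ := Submodule.exists_mem_ne_zero_of_ne_bot hKo
      exact ⟨e₀, Submodule.inner_right_of_mem_orthogonal (Submodule.mem_span_singleton_self u)
        he₀K, he₀⟩
  refine ⟨(r / ‖e₀‖) • e₀, by rw [inner_smul_right, he₀u, mul_zero], ?_⟩
  rw [norm_smul, Real.norm_eq_abs, abs_of_nonneg (by positivity),
    div_mul_cancel₀ r (norm_ne_zero_iff.2 he₀)]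

/-- **Great circles.** If `‖u‖ = ‖v‖ = r > 0` (dimension `≥ 2`) and `θ = ∠(u, v)`, there is `e`
with `e ⊥ u`, `‖e‖ = r` and `v = cos θ • u + sin θ • e` (for `sin θ ≠ 0`,
`e = (sin θ)⁻¹ (v - cos θ • u)`; for `v = ± u` any orthogonal `e` of norm `r`). [folklore] -/
theorem exists_eq_cos_angle_smul_add_sin_angle_smul (hE : 2 ≤ finrank ℝ E) {u v : E} {r : ℝ}
    (hr : 0 < r) (hu : ‖u‖ = r) (hv : ‖v‖ = r) :
    ∃ e : E, ⟪u, e⟫ = 0 ∧ ‖e‖ = r ∧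
      v = Real.cos (angle u v) • u + Real.sin (angle u v) • e := by
  set θ := angle u v with hθ
  have hcos : Real.cos θ = ⟪u, v⟫ / (r * r) := by rw [hθ, cos_angle, hu, hv]
  have huu : ⟪u, u⟫ = r * r := by rw [real_inner_self_eq_norm_mul_norm, hu]
  have hvv : ⟪v, v⟫ = r * r := by rw [real_inner_self_eq_norm_mul_norm, hv]
  have huv : ⟪u, v⟫ = Real.cos θ * (r * r) := by
    rw [hcos, div_mul_cancel₀ _ (by positivity)]
  -- the orthogonal component
  set w : E := v - Real.cos θ • u with hw
  have hwu : ⟪u, w⟫ = 0 := by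
    rw [hw, inner_sub_right, inner_smul_right, huv, huu]; ring
  have hww : ⟪w, w⟫ = Real.sin θ ^ 2 * (r * r) := by
    have : ⟪w, w⟫ = ⟪v, v⟫ - 2 * Real.cos θ * ⟪u, v⟫ + Real.cos θ ^ 2 * ⟪u, u⟫ := by
      rw [hw, inner_sub_left, inner_sub_right, inner_sub_right, inner_smul_left,
        inner_smul_right, inner_smul_left, inner_smul_right, real_inner_comm u v]
      simp only [conj_trivial]
      ring
    rw [this, hvv, huv, huu, Real.sin_sq]
    ring
  by_cases hsin : Real.sin θ = 0
  · -- `v = cos θ • u`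
    have hw0 : w = 0 := by
      rw [← inner_self_eq_zero (𝕜 := ℝ), hww, hsin]; ring
    obtain ⟨e, heu, he⟩ := exists_inner_eq_zero_norm_eq hE u hr.le
    refine ⟨e, heu, he, ?_⟩
    rw [hsin, zero_smul, add_zero]
    rw [hw, sub_eq_zero] at hw0
    exact hw0
  · refine ⟨(Real.sin θ)⁻¹ • w, by rw [inner_smul_right, hwu, mul_zero], ?_, ?_⟩
    · have hsq : ‖(Real.sin θ)⁻¹ • w‖ ^ 2 = r ^ 2 := by
        rw [norm_smul, norm_inv, Real.norm_eq_abs, mul_pow, inv_pow, sq_abs,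
          ← real_inner_self_eq_norm_sq, hww, ← mul_assoc, inv_mul_cancel₀ (pow_ne_zero 2 hsin),
          one_mul, sq]
      have h := (sq_eq_sq₀ (norm_nonneg _) hr.le).1 hsq
      exact h
    · rw [smul_smul, mul_inv_cancel₀ hsin, one_smul, hw, add_sub_cancel]

omit [FiniteDimensional ℝ E] in
/-- **Mean value inequality along a great-circle arc.** If `h : E → ℝ` is differentiable with
`‖Dh(z)‖ ≤ B` on the sphere `‖z‖ = r`, `u ⊥ e`, `‖u‖ = ‖e‖ = r` and `θ ≥ 0`, then
`|h(cos θ • u + sin θ • e) - h(u)| ≤ B r θ` (the arc `t ↦ cos t • u + sin t • e` stays on the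
sphere and has speed `r`). [folklore] -/
theorem abs_sub_le_great_circle {h : E → ℝ} (hd : Differentiable ℝ h) {u e : E} {r B θ : ℝ}
    (hue : ⟪u, e⟫ = 0) (hu : ‖u‖ = r) (he : ‖e‖ = r) (hθ : 0 ≤ θ)
    (hB : ∀ z : E, ‖z‖ = r → ‖fderiv ℝ h z‖ ≤ B) :
    |h (Real.cos θ • u + Real.sin θ • e) - h u| ≤ B * r * θ := by
  have hr : 0 ≤ r := hu ▸ norm_nonneg u
  set γ : ℝ → E := fun t => Real.cos t • u + Real.sin t • e with hγ
  set γ' : ℝ → E := fun t => -Real.sin t • u + Real.cos t • e with hγ'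
  -- norms on the circle
  have hnorm : ∀ c s : ℝ, c ^ 2 + s ^ 2 = 1 → ‖c • u + s • e‖ = r := fun c s hcs => by
    have heu : ⟪e, u⟫ = 0 := by rw [real_inner_comm]; exact hue
    have hsq : ‖c • u + s • e‖ ^ 2 = r ^ 2 := by
      rw [← real_inner_self_eq_norm_sq, inner_add_left, inner_add_right, inner_add_right,
        inner_smul_left, inner_smul_right, inner_smul_left, inner_smul_right, inner_smul_left,
        inner_smul_right, inner_smul_left, inner_smul_right, hue, heu,
        real_inner_self_eq_norm_sq, real_inner_self_eq_norm_sq, hu, he]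
      simp only [conj_trivial]
      linear_combination r ^ 2 * hcs
    exact (sq_eq_sq₀ (norm_nonneg _) hr).1 hsq
  have hγn : ∀ t, ‖γ t‖ = r := fun t => hnorm _ _ (Real.cos_sq_add_sin_sq t)
  have hγ'n : ∀ t, ‖γ' t‖ = r := fun t =>
    hnorm (-Real.sin t) (Real.cos t) (by rw [neg_sq]; linarith [Real.cos_sq_add_sin_sq t])
  -- derivative of the arc and of `h` along it
  have hγd : ∀ t, HasDerivAt γ (γ' t) t := fun t =>
    ((Real.hasDerivAt_cos t).smul_const u).add ((Real.hasDerivAt_sin t).smul_const e)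
  set g : ℝ → ℝ := fun t => h (γ t) with hg
  have hgd : ∀ t, HasDerivAt g (fderiv ℝ h (γ t) (γ' t)) t := fun t =>
    (hd (γ t)).hasFDerivAt.comp_hasDerivAt t (hγd t)
  have hbound : ∀ t ∈ Ico (0 : ℝ) θ, ‖fderiv ℝ h (γ t) (γ' t)‖ ≤ B * r := fun t _ => by
    calc ‖fderiv ℝ h (γ t) (γ' t)‖ ≤ ‖fderiv ℝ h (γ t)‖ * ‖γ' t‖ :=
          ContinuousLinearMap.le_opNorm _ _
      _ ≤ B * r := by
          rw [hγ'n t]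
          exact mul_le_mul_of_nonneg_right (hB _ (hγn t)) hr
  have hmvt := norm_image_sub_le_of_norm_deriv_le_segment' (f := g)
    (fun t _ => (hgd t).hasDerivWithinAt) hbound θ (right_mem_Icc.2 hθ)
  have hg0 : g 0 = h u := by simp [hg, hγ]
  have hgθ : g θ = h (Real.cos θ • u + Real.sin θ • e) := rfl
  rw [hg0, hgθ, sub_zero, Real.norm_eq_abs] at hmvt
  linarith [hmvt]

omit [FiniteDimensional ℝ E] in
/-- **Mean value inequality along a radial segment.** If `h` is differentiable with `‖Dh‖ ≤ B`
on the shell `a ≤ ‖z‖ ≤ b` and `x ≠ 0`, `s` have `‖x‖, s ∈ [a, b]`, then for the radial point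
`x' = (s / ‖x‖) • x` (of norm `s`), `|h(x') - h(x)| ≤ B (b - a)`. [folklore] -/
theorem abs_sub_le_radial_segment {h : E → ℝ} (hd : Differentiable ℝ h) {a b B s : ℝ}
    (hB : ∀ z : E, a ≤ ‖z‖ → ‖z‖ ≤ b → ‖fderiv ℝ h z‖ ≤ B) {x : E} (hx : x ≠ 0)
    (hxa : a ≤ ‖x‖) (hxb : ‖x‖ ≤ b) (hs : 0 ≤ s) (hsa : a ≤ s) (hsb : s ≤ b) :
    |h ((s / ‖x‖) • x) - h x| ≤ B * (b - a) := by
  have hx0 : 0 < ‖x‖ := norm_pos_iff.2 hx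
  set x' : E := (s / ‖x‖) • x with hx'
  -- the segment stays in the shell
  have hseg : ∀ z ∈ segment ℝ x x', a ≤ ‖z‖ ∧ ‖z‖ ≤ b := by
    intro z hz
    rw [segment_eq_image] at hz
    obtain ⟨t, ⟨ht0, ht1⟩, rfl⟩ := hz
    have hz : (1 - t) • x + t • x' = ((1 - t) + t * (s / ‖x‖)) • x := by
      rw [hx', smul_smul, add_smul]
    have hcoef : 0 ≤ (1 - t) + t * (s / ‖x‖) := by
      have : 0 ≤ s / ‖x‖ := div_nonneg hs hx0.le
      have : 0 ≤ 1 - t := sub_nonneg.2 ht1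
      positivity
    have hnorm : ‖(1 - t) • x + t • x'‖ = (1 - t) * ‖x‖ + t * s := by
      rw [hz, norm_smul, Real.norm_eq_abs, abs_of_nonneg hcoef, add_mul, mul_assoc,
        div_mul_cancel₀ s hx0.ne']
    rw [hnorm]
    have h1 : 0 ≤ (1 - t) * (‖x‖ - a) := mul_nonneg (sub_nonneg.2 ht1) (sub_nonneg.2 hxa)
    have h2 : 0 ≤ t * (s - a) := mul_nonneg ht0 (sub_nonneg.2 hsa)
    have h3 : 0 ≤ (1 - t) * (b - ‖x‖) := mul_nonneg (sub_nonneg.2 ht1) (sub_nonneg.2 hxb)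
    have h4 : 0 ≤ t * (b - s) := mul_nonneg ht0 (sub_nonneg.2 hsb)
    constructor
    · nlinarith
    · nlinarith
  have hB' : ∀ z ∈ segment ℝ x x', ‖fderiv ℝ h z‖ ≤ B := fun z hz =>
    hB z (hseg z hz).1 (hseg z hz).2
  have hmvt := (convex_segment x x').norm_image_sub_le_of_norm_fderiv_le
    (fun z _ => hd z) hB' (left_mem_segment ℝ x x') (right_mem_segment ℝ x x')
  have hdist : ‖x' - x‖ ≤ b - a := by
    have : x' - x = (s / ‖x‖ - 1) • x := by rw [hx', sub_smul, one_smul]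
    rw [this, norm_smul, Real.norm_eq_abs]
    have : |s / ‖x‖ - 1| * ‖x‖ = |s - ‖x‖| := by
      rw [← abs_of_pos hx0, ← abs_mul, abs_of_pos hx0]
      congr 1
      field_simp
    rw [this]
    exact abs_sub_le_iff.2 ⟨by linarith, by linarith⟩
  have hB0 : 0 ≤ B := le_trans (norm_nonneg _) (hB x hxa hxb)
  rw [Real.norm_eq_abs] at hmvt
  calc |h x' - h x| ≤ B * ‖x' - x‖ := hmvt
    _ ≤ B * (b - a) := mul_le_mul_of_nonneg_left hdist hB0

/-- **Oscillation over a spherical shell from a gradient bound.** Let `h : E → ℝ` be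
differentiable (dimension `≥ 2`) with `‖Dh(z)‖ ≤ B` for `a ≤ ‖z‖ ≤ b`, `0 < a ≤ b`. Then for all
`x, y` in the shell, `|h(x) - h(y)| ≤ B ((b - a) + π b)`: join `x` radially to `x' = (‖y‖/‖x‖) x`
(length `≤ b - a`) and `x'` to `y` along a great circle of radius `‖y‖ ≤ b` (length `≤ π b`), both
inside the shell. [folklore] -/
theorem abs_sub_le_of_norm_fderiv_le_shell (hE : 2 ≤ finrank ℝ E) {h : E → ℝ}
    (hd : Differentiable ℝ h) {a b B : ℝ} (ha : 0 < a)
    (hB : ∀ z : E, a ≤ ‖z‖ → ‖z‖ ≤ b → ‖fderiv ℝ h z‖ ≤ B) {x y : E}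
    (hxa : a ≤ ‖x‖) (hxb : ‖x‖ ≤ b) (hya : a ≤ ‖y‖) (hyb : ‖y‖ ≤ b) :
    |h x - h y| ≤ B * ((b - a) + Real.pi * b) := by
  have hx0 : x ≠ 0 := norm_pos_iff.1 (ha.trans_le hxa)
  have hr : 0 < ‖y‖ := ha.trans_le hya
  have hB0 : 0 ≤ B := le_trans (norm_nonneg _) (hB x hxa hxb)
  set x' : E := (‖y‖ / ‖x‖) • x with hx'
  have hx'n : ‖x'‖ = ‖y‖ := by
    rw [hx', norm_smul, Real.norm_eq_abs, abs_of_nonneg (by positivity),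
      div_mul_cancel₀ _ (norm_pos_iff.2 hx0).ne']
  -- radial part
  have h1 : |h x' - h x| ≤ B * (b - a) :=
    abs_sub_le_radial_segment hd hB hx0 hxa hxb hr.le hya hyb
  -- spherical part
  obtain ⟨e, hxe, he, hy⟩ := exists_eq_cos_angle_smul_add_sin_angle_smul hE hr hx'n rfl
  have h2 : |h y - h x'| ≤ B * ‖y‖ * angle x' y := by
    have := abs_sub_le_great_circle hd hxe hx'n he (angle_nonneg x' y)
      (fun z hz => hB z (hz ▸ hya) (hz ▸ hyb))
    rwa [← hy] at this
  have h3 : B * ‖y‖ * angle x' y ≤ B * (Real.pi * b) := by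
    rw [mul_assoc]
    refine mul_le_mul_of_nonneg_left ?_ hB0
    rw [mul_comm]
    exact mul_le_mul (angle_le_pi _ _) hyb hr.le Real.pi_pos.le
  calc |h x - h y| = |(h x - h x') + (h x' - h y)| := by rw [sub_add_sub_cancel]
    _ ≤ |h x - h x'| + |h x' - h y| := abs_add_le _ _
    _ = |h x' - h x| + |h y - h x'| := by rw [abs_sub_comm (h x) (h x'), abs_sub_comm (h x') (h y)]
    _ ≤ B * (b - a) + B * (Real.pi * b) := add_le_add h1 (h2.trans h3)
    _ = B * ((b - a) + Real.pi * b) := by ring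

end Literature.Analysis.FluidPDE

end
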